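import Mathlib
import Summits.Ventures.PercRepro.TriangleCapCoveredReduction
import Summits.Ventures.PercRepro.TriangleCapW29Refutation

/-!
# PercRepro — the kill witness `W29` is in the CORE CLASS: `¬ ExistsDeltaCocircuitCore (Fin 29)` (p3, gen 27)

The chain of record of the triangle-cap lane is `T ≤ P_KK(ν) ⟸ ExistsDeltaCocircuitCore ⟸
ExistsDeltaCocircuitInsep ⟸ ExistsDeltaCocircuit` (TriangleCapDeltaForm, TriangleCapSplitReduction,
TriangleCapCoveredReduction).  TriangleCapW29Refutation refutes the bottom hypothesis on `Fin 29`; this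
file refutes the TOP one: `W29` is covered (every point on a triangle) and triangle-inseparable (its
triangle hypergraph is connected), so the cocircuit asked of core-class matroids is asked of `W29` too,
and `W29` has none.

* `covered : TriangleCovered M` — `coveredCert` (`decide +kernel`: every point lies on one of the `60`
  triangles);
* `not_split : ¬ HasTriangleSplit M` — an explicit ordering `ord` of the `60` triangles in which every
  triangle after the first meets an earlier one (`ord_connected`, `decide +kernel`); in a split every
  triangle lies in one part, two triangles sharing a point lie in the same part (`Disjoint`), so by strong
  induction every triangle lies in the part of `ord 0` — against the triangles in both parts;
* **`not_existsDeltaCocircuitCore : ¬ ExistsDeltaCocircuitCore (Fin 29)`** and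
  **`not_existsDeltaCocircuitInsep : ¬ ExistsDeltaCocircuitInsep (Fin 29)`**.

Axioms: standard.
-/

open scoped Matroid

namespace PercRepro

namespace TriangleCap

namespace W29

open Set Matroid

/-- A connected ordering of the `60` triangles (breadth-first from `{0, 1, 2}`). -/
def ord : Fin 60 → Finset (Fin 29) :=
  ![{0, 1, 2}, {0, 3, 5}, {0, 10, 12}, {0, 11, 13}, {0, 22, 23}, {0, 26, 28}, {1, 3, 6}, {1, 14, 16},
    {1, 15, 17}, {1, 23, 24}, {1, 25, 28}, {2, 5, 6}, {2, 7, 8}, {2, 18, 20}, {2, 22, 24}, {2, 25, 26},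
    {3, 8, 11}, {3, 9, 10}, {3, 15, 18}, {3, 16, 19}, {4, 8, 12}, {4, 9, 13}, {4, 14, 18}, {4, 17, 19},
    {4, 22, 25}, {4, 24, 26}, {5, 8, 13}, {5, 9, 12}, {5, 17, 20}, {5, 21, 25}, {5, 24, 27}, {6, 7, 13},
    {6, 14, 19}, {6, 17, 18}, {6, 21, 26}, {6, 22, 27}, {7, 14, 23}, {7, 15, 21}, {7, 16, 24},
    {7, 20, 28}, {8, 16, 22}, {8, 18, 28}, {9, 15, 24}, {9, 16, 21}, {9, 17, 23}, {10, 14, 26},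
    {10, 18, 24}, {10, 19, 21}, {10, 20, 22}, {11, 14, 27}, {11, 15, 28}, {11, 17, 25}, {11, 19, 22},
    {11, 20, 21}, {12, 14, 28}, {12, 15, 27}, {12, 16, 25}, {12, 20, 23}, {13, 15, 26}, {13, 19, 23}]

/-- The triangles are exactly the members of `ord`. -/
theorem tri_eq_image : tri = Finset.univ.image ord := by decide +kernel

/-- Every point of `W29` lies on one of the triangles of `ord`. -/
theorem coveredCert : ∀ x : Fin 29, ∃ j : Fin 60, x ∈ ord j := by decide +kernel

/-- Every triangle after the first meets an earlier one. -/
theorem ord_connected : ∀ j : Fin 60, 0 < j.val →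
    ∃ i : Fin 60, i.val < j.val ∧ (ord i ∩ ord j).Nonempty := by decide +kernel

/-- Every member of `ord` is a triangle. -/
theorem ord_mem_tri (j : Fin 60) : ord j ∈ tri := by
  rw [tri_eq_image]
  exact Finset.mem_image_of_mem ord (Finset.mem_univ j)

/-- Every triangle is a member of `ord`. -/
theorem exists_ord_eq {t : Finset (Fin 29)} (ht : t ∈ tri) : ∃ j : Fin 60, ord j = t := by
  rw [tri_eq_image, Finset.mem_image] at ht
  obtain ⟨j, -, hj⟩ := ht
  exact ⟨j, hj⟩

/-- `W29` is covered. -/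
theorem covered : Cocirc.TriangleCovered M := by
  intro x _
  obtain ⟨j, hxj⟩ := coveredCert x
  exact ⟨↑(ord j), mem_triangles_iff.2 ⟨ord j, ord_mem_tri j, rfl⟩, Finset.mem_coe.2 hxj⟩

/-- A triangle inside one part of a split is not inside the other. -/
theorem not_subset_of_subset {A B : Set (Fin 29)} (hAB : Disjoint A B) {t : Finset (Fin 29)}
    (ht : t ∈ tri) (hA : (t : Set (Fin 29)) ⊆ A) : ¬ (t : Set (Fin 29)) ⊆ B := by
  intro hB
  have hcard : t.card = 3 := (Finset.mem_powersetCard_univ.1 (Finset.mem_filter.1 ht).1)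
  obtain ⟨x, hx⟩ : t.Nonempty := Finset.card_pos.1 (by omega)
  exact Set.disjoint_left.1 hAB (hA (Finset.mem_coe.2 hx)) (hB (Finset.mem_coe.2 hx))

/-- In a split, every triangle of `ord` lies in the part of `ord 0`. -/
theorem side_eq {A B : Set (Fin 29)} (hAB : Disjoint A B)
    (hall : ∀ C ∈ ThmN.triangles M, C ⊆ A ∨ C ⊆ B) :
    ∀ j : Fin 60, ((ord j : Set (Fin 29)) ⊆ A ↔ (ord 0 : Set (Fin 29)) ⊆ A) := by
  have hside : ∀ j : Fin 60, (ord j : Set (Fin 29)) ⊆ A ∨ (ord j : Set (Fin 29)) ⊆ B :=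
    fun j => hall _ (mem_triangles_iff.2 ⟨ord j, ord_mem_tri j, rfl⟩)
  suffices H : ∀ n : ℕ, ∀ j : Fin 60, j.val = n →
      ((ord j : Set (Fin 29)) ⊆ A ↔ (ord 0 : Set (Fin 29)) ⊆ A) from fun j => H j.val j rfl
  intro n
  induction n using Nat.strong_induction_on with
  | _ n ih =>
  intro j hj
  by_cases h0 : j.val = 0
  · have : j = 0 := Fin.ext h0
    rw [this]
  obtain ⟨i, hij, x, hx⟩ := ord_connected j (Nat.pos_of_ne_zero h0)
  rw [Finset.mem_inter] at hx
  have hi := ih i.val (by omega) i rfl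
  rw [← hi]
  constructor
  · intro hjA
    rcases hside i with hiA | hiB
    · exact hiA
    · exact absurd (hiB (Finset.mem_coe.2 hx.1)) (Set.disjoint_left.1 hAB (hjA (Finset.mem_coe.2 hx.2)))
  · intro hiA
    rcases hside j with hjA | hjB
    · exact hjA
    · exact absurd (hjB (Finset.mem_coe.2 hx.2)) (Set.disjoint_left.1 hAB (hiA (Finset.mem_coe.2 hx.1)))

/-- `W29` has no triangle split: its triangle hypergraph is connected. -/
theorem not_split : ¬ Cocirc.HasTriangleSplit M := by
  rintro ⟨A, B, -, hAB, ⟨CA, hCA, hCAA⟩, ⟨CB, hCB, hCBB⟩, hall⟩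
  obtain ⟨tA, htA, rfl⟩ := mem_triangles_iff.1 hCA
  obtain ⟨tB, htB, rfl⟩ := mem_triangles_iff.1 hCB
  obtain ⟨jA, hjA⟩ := exists_ord_eq htA
  obtain ⟨jB, hjB⟩ := exists_ord_eq htB
  have h0A : (ord 0 : Set (Fin 29)) ⊆ A := (side_eq hAB hall jA).1 (by rw [hjA]; exact hCAA)
  have hBA : (ord jB : Set (Fin 29)) ⊆ A := (side_eq hAB hall jB).2 h0A
  rw [hjB] at hBA
  exact not_subset_of_subset hAB htB hBA hCBB

/-- **The core-class Δ-existence hypothesis is false**: `W29` is a covered, triangle-inseparable `Core3`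
matroid with a triangle, and no cocircuit of it meets the Δ bound. -/
theorem not_existsDeltaCocircuitCore : ¬ Cocirc.ExistsDeltaCocircuitCore (Fin 29) := by
  intro h
  haveI := M_finite
  obtain ⟨K, hK, hg⟩ := h M core3 triangles_nonempty not_split covered 23 encard_eq
  obtain ⟨n, hn0, rfl⟩ := cocircuit_eq hK
  rw [gain_eq, ncard_coe_finset] at hg
  exact absurd hg (not_le.2 (cert n hn0))

/-- **The inseparable Δ-existence hypothesis is false** on `Fin 29`. -/
theorem not_existsDeltaCocircuitInsep : ¬ Cocirc.ExistsDeltaCocircuitInsep (Fin 29) :=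
  fun h => not_existsDeltaCocircuitCore (Cocirc.existsDeltaCocircuitCore_of_existsDeltaCocircuitInsep h)

end W29

end TriangleCap

end PercRepro
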